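import Mathlib
import Literature.Analysis.FluidPDE.JiaSverak2014PerturbedOnSlab
import Literature.Analysis.FluidPDE.PressureDeterminedUpToTime
import Literature.Analysis.FluidPDE.ClassicalSuitable
import Literature.Analysis.FluidPDE.SuitableWeakPressure
import Literature.Analysis.FluidPDE.WeakSolutionProofs
import Literature.Analysis.FluidPDE.LocalTypeICongr
import Literature.Analysis.FluidPDE.LocalTypeIReverseTools
import Literature.Analysis.FluidPDE.LocalTypeILscPressure
import Literature.Analysis.FluidPDE.SuitableWeakRescaling
import Summits.NavierStokesRegularity.NavierStokesRegularity.Theorems.HardyPointSinkHardyAncientLimitPressureD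
import Summits.NavierStokesRegularity.NavierStokesRegularity.Theorems.HardyPointSinkHardyAncientLimitAssemblyB
import HarnessLib

/-!
# `DulacContraction.SmoothRepresentative` (stmt-NavierStokesRegularity-8562) — tools: the classical
# pressure of a slab profile does not change Albritton–Barker's `𝐈`

Helper file (`--supports stmt-NavierStokesRegularity-8562`; theorems only). For a suitable weak
solution `(v, p)` of the unit-viscosity Navier–Stokes system on the backward slab `ℝ³ × ℝ₋` whose
velocity `v` is also a CLASSICAL solution `(v, q)` on `(−∞, 0)` for some smooth pressure `q`:

* `exists_gauge_of_distributional_of_classical` — on every window `(T₁, T₂)` the two pressures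
  differ by a measurable function of time, `p − q = c(t)` a.e. (subtract the two distributional
  momentum identities, then the tree's `exists_measurable_gauge_of_forall_integral_mul_divergence_eq_zero`;
  Rusin–Šverák 2011, §2: "we can change the pressure by any function of `t` only"; same proof as the
  tree's `JiaSverak2014.exists_gauge_two_pressures`, stated there for local Leray solutions);
* `cknDOsc_congr_ae_slices` — the mean-oscillation quantity `D(Q(z,r); ·)` only sees the slices
  a.e. (Tonelli);
* `cknDOsc_classical_eq` — hence `D(Q(z,r); q) = D(Q(z,r); p)` on every backward ball (`D` ignores
  functions of time, `HardyAncientLimit.cknDOsc_sub_timeFun'`);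
* `typeIBound_classical_eq` — and `𝐈(ℝ³ × ℝ₋; v, q, G) = 𝐈(ℝ³ × ℝ₋; u, p, G)` whenever `u = v`
  a.e. on the slab (`A`, `C` by `cknAEss_congr_ae` / `cknC_congr_ae`, `E` from the same `G`).

HONEST FRAMING: bookkeeping about the pressure of HYPOTHETICAL slab profiles (Albritton–Barker 2019,
§1: the pressure of an ancient solution is determined up to a function of time, invisible to `D`);
nothing here bears on the regularity problem itself.

References: D. Albritton, T. Barker, arXiv:1811.00502, §1, §3; W. Rusin, V. Šverák, J. Funct.
Anal. 260 (2011), §2; H. Jia, V. Šverák, Invent. Math. 196 (2014), §3 (3.3).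
-/

noncomputable section

set_option linter.dupNamespace false

namespace Summit.NavierStokesRegularity.NavierStokesRegularity.Theorems

open MeasureTheory TopologicalSpace Set Function Filter Metric
open Literature.Analysis.FluidPDE
open scoped ENNReal NNReal RealInnerProductSpace Laplacian

namespace SmoothRepresentative

/-- **Two pressures of one velocity differ by a function of time** (Rusin–Šverák 2011, §2;
Jia–Šverák 2014, §3 (3.3)). Let `(v, p)` solve Navier–Stokes (`ν = 1`, `f = 0`) in the sense of
distributions on the slab `(T₁, T₂) × ℝ³` and let `(v, q)` be a classical solution on an open time
set `S ⊇ (T₁, T₂)`, with the SAME velocity `v`. Then `∫∫ (p − q) div ψ = 0` for every vector test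
field `ψ` on the slab (subtract the two momentum identities), hence there is a measurable `c` with
`p − q = c(t)` a.e. on the slab (`exists_measurable_gauge_of_forall_integral_mul_divergence_eq_zero`).
Same proof as the tree's `JiaSverak2014.exists_gauge_two_pressures` (stated there for local Leray
solutions), with the distributional identity as the hypothesis.
[cite: RusinSverak2011, §2 p. 4; JiaSverak2014, §3 (3.3)] -/
theorem exists_gauge_of_distributional_of_classical {T₁ T₂ : ℝ}
    {v : ℝ → EuclideanSpace ℝ (Fin 3) → EuclideanSpace ℝ (Fin 3)}
    {p q : ℝ → EuclideanSpace ℝ (Fin 3) → ℝ}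
    (hD₁ : IsDistributionalNSSolutionOn
      (slab (EuclideanSpace ℝ (Fin 3)) (Ioo T₁ T₂) isOpen_Ioo) 1 0 v p)
    {S : Set ℝ} (hS : IsOpen S) (hTS : Ioo T₁ T₂ ⊆ S)
    (hcl : IsClassicalNSSolutionOn S 1 0 v q) :
    ∃ c : ℝ → ℝ, Measurable c ∧
      ∀ᵐ t ∂(volume.restrict (Ioo T₁ T₂)),
        ∀ᵐ x ∂(volume : Measure (EuclideanSpace ℝ (Fin 3))), p t x - q t x = c t := by
  set Q : Opens (ℝ × (EuclideanSpace ℝ (Fin 3))) :=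
    slab (EuclideanSpace ℝ (Fin 3)) (Ioo T₁ T₂) isOpen_Ioo with hQ
  have hQS : (Q : Set (ℝ × (EuclideanSpace ℝ (Fin 3)))) ⊆
      S ×ˢ (univ : Set (EuclideanSpace ℝ (Fin 3))) := prod_mono hTS Subset.rfl
  -- the classical pair is a distributional solution on `Q`
  have hv2 : ContDiffOn ℝ 2 (uncurry v) (S ×ˢ (univ : Set (EuclideanSpace ℝ (Fin 3)))) :=
    hcl.smooth_velocity.of_le (by norm_cast)
  have hq1 : ContDiffOn ℝ 1 (uncurry q) (S ×ˢ (univ : Set (EuclideanSpace ℝ (Fin 3)))) :=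
    hcl.smooth_pressure.of_le (by norm_cast)
  have hmom : ∀ t ∈ S, ∀ x, timeDeriv v t x + convect (v t) (v t) x =
      (1 : ℝ) • (Δ (v t)) x - gradient (q t) x +
        (0 : ℝ → (EuclideanSpace ℝ (Fin 3)) → (EuclideanSpace ℝ (Fin 3))) t x := by
    intro t ht x
    have h := hcl.momentum t ht x
    rwa [timeDerivWithin_of_mem_interior (by rwa [hS.interior_eq]) x] at h
  have hD₂ : IsDistributionalNSSolutionOn Q 1 0 v q :=
    isDistributionalNSSolutionOn_of_contDiffOn hS hQS hv2 hq1
      (continuous_const.continuousOn) hmom hcl.divFree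
  -- local integrability of `F = p - q` on the slab
  have hqc : ContinuousOn (uncurry q) (Q : Set (ℝ × (EuclideanSpace ℝ (Fin 3)))) :=
    hq1.continuousOn.mono hQS
  have hF : LocallyIntegrableOn (uncurry fun t x => p t x - q t x)
      (Ioo T₁ T₂ ×ˢ (univ : Set (EuclideanSpace ℝ (Fin 3)))) volume :=
    hD₁.2.2.1.sub (hqc.locallyIntegrableOn (measurableSet_Ioo.prod MeasurableSet.univ))
  refine exists_measurable_gauge_of_forall_integral_mul_divergence_eq_zero hF fun ψ hψ => ?_
  -- subtract the two momentum identities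
  have h₁ := hD₁.2.2.2.2 ψ hψ
  have h₂ := hD₂.2.2.2.2 ψ hψ
  set K : Set (ℝ × (EuclideanSpace ℝ (Fin 3))) := tsupport (uncurry ψ) with hK
  have hKc : IsCompact K := hψ.hasCompactSupport
  have hKQ : K ⊆ (Q : Set (ℝ × (EuclideanSpace ℝ (Fin 3)))) := hψ.tsupport_subset
  have hψ' : IsSpaceTimeTestOn (⊤ : Opens (ℝ × (EuclideanSpace ℝ (Fin 3)))) ψ := hψ.mono le_top
  have hdivc : Continuous fun z : ℝ × (EuclideanSpace ℝ (Fin 3)) =>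
      VectorCalculus.divergence (ψ z.1) z.2 := hψ'.continuous_divergence_slice
  have hdiv0 : ∀ z ∉ K, VectorCalculus.divergence (ψ z.1) z.2 = 0 := fun z hz => by
    have h0 : fderiv ℝ (ψ z.1) z.2 = 0 :=
      IsSpaceTimeTestOn.fderiv_slice_eq_zero_of_notMem (ψ := ψ) hz
    simp [VectorCalculus.divergence, h0]
  have iP₁ : Integrable (fun z : ℝ × (EuclideanSpace ℝ (Fin 3)) =>
      p z.1 z.2 * VectorCalculus.divergence (ψ z.1) z.2) volume :=
    integrable_mul_of_locallyIntegrableOn hD₁.2.2.1 hdivc hKc hKQ hdiv0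
  have iP₂ : Integrable (fun z : ℝ × (EuclideanSpace ℝ (Fin 3)) =>
      q z.1 z.2 * VectorCalculus.divergence (ψ z.1) z.2) volume :=
    integrable_mul_of_locallyIntegrableOn hD₂.2.2.1 hdivc hKc hKQ hdiv0
  set V : ℝ × (EuclideanSpace ℝ (Fin 3)) → ℝ := fun z =>
    ⟪v z.1 z.2, timeDeriv ψ z.1 z.2⟫ + ⟪v z.1 z.2, convect (v z.1) (ψ z.1) z.2⟫ +
      1 * ⟪v z.1 z.2, Δ (ψ z.1) z.2⟫ with hV
  have hV0 : ∀ z ∉ K, V z = 0 := fun z hz => by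
    simp only [hV, IsSpaceTimeTestOn.timeDeriv_eq_zero_of_notMem hz,
      laplacian_eq_zero_of_notMem_tsupport (notMem_tsupport_slice hz), inner_zero_right,
      mul_zero, add_zero, convect, IsSpaceTimeTestOn.fderiv_slice_eq_zero_of_notMem (ψ := ψ) hz,
      zero_apply]
  have hVc : ContinuousOn V (Q : Set (ℝ × (EuclideanSpace ℝ (Fin 3)))) := by
    have hvc : ContinuousOn (fun z : ℝ × (EuclideanSpace ℝ (Fin 3)) => v z.1 z.2)
        (Q : Set (ℝ × (EuclideanSpace ℝ (Fin 3)))) := hv2.continuousOn.mono hQS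
    have hDψ : Continuous fun z : ℝ × (EuclideanSpace ℝ (Fin 3)) => fderiv ℝ (ψ z.1) z.2 :=
      hψ'.continuous_fderiv_slice
    refine ((hvc.inner hψ'.continuous_timeDeriv.continuousOn).add (hvc.inner ?_)).add
      (continuousOn_const.mul (hvc.inner hψ'.continuous_laplacian_slice.continuousOn))
    exact ((hDψ.continuousOn).clm_apply hvc)
  have iV : Integrable V volume := by
    have hVK : IntegrableOn V K volume := (hVc.mono hKQ).integrableOn_compact hKc
    exact hVK.integrable_of_forall_notMem_eq_zero hV0
  have e₁ : ∫ (z : ℝ × (EuclideanSpace ℝ (Fin 3))) in (Q : Set (ℝ × (EuclideanSpace ℝ (Fin 3)))),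
      (⟪v z.1 z.2, timeDeriv ψ z.1 z.2⟫ + ⟪v z.1 z.2, convect (v z.1) (ψ z.1) z.2⟫ +
      1 * ⟪v z.1 z.2, Δ (ψ z.1) z.2⟫ + p z.1 z.2 * VectorCalculus.divergence (ψ z.1) z.2 +
      ⟪(0 : ℝ → (EuclideanSpace ℝ (Fin 3)) → (EuclideanSpace ℝ (Fin 3))) z.1 z.2, ψ z.1 z.2⟫) =
      (∫ z, V z) + ∫ z : ℝ × (EuclideanSpace ℝ (Fin 3)),
        p z.1 z.2 * VectorCalculus.divergence (ψ z.1) z.2 := by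
    rw [setIntegral_eq_integral_of_forall_compl_eq_zero (fun z hz => by
      have hzK : z ∉ K := fun h => hz (hKQ h)
      simp only [hV] at hV0
      rw [hV0 z hzK, hdiv0 z hzK]; simp), ← integral_add iV iP₁]
    refine integral_congr_ae (Eventually.of_forall fun z => ?_)
    simp only [hV, Pi.zero_apply, inner_zero_left, add_zero]
  have e₂ : ∫ (z : ℝ × (EuclideanSpace ℝ (Fin 3))) in (Q : Set (ℝ × (EuclideanSpace ℝ (Fin 3)))),
      (⟪v z.1 z.2, timeDeriv ψ z.1 z.2⟫ + ⟪v z.1 z.2, convect (v z.1) (ψ z.1) z.2⟫ +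
      1 * ⟪v z.1 z.2, Δ (ψ z.1) z.2⟫ + q z.1 z.2 * VectorCalculus.divergence (ψ z.1) z.2 +
      ⟪(0 : ℝ → (EuclideanSpace ℝ (Fin 3)) → (EuclideanSpace ℝ (Fin 3))) z.1 z.2, ψ z.1 z.2⟫) =
      (∫ z, V z) + ∫ z : ℝ × (EuclideanSpace ℝ (Fin 3)),
        q z.1 z.2 * VectorCalculus.divergence (ψ z.1) z.2 := by
    rw [setIntegral_eq_integral_of_forall_compl_eq_zero (fun z hz => by
      have hzK : z ∉ K := fun h => hz (hKQ h)
      simp only [hV] at hV0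
      rw [hV0 z hzK, hdiv0 z hzK]; simp), ← integral_add iV iP₂]
    refine integral_congr_ae (Eventually.of_forall fun z => ?_)
    simp only [hV, Pi.zero_apply, inner_zero_left, add_zero]
  rw [e₁] at h₁
  rw [e₂] at h₂
  rw [setIntegral_eq_integral_of_forall_compl_eq_zero (fun z hz => by
    have hzK : z ∉ K := fun h => hz (hKQ h)
    rw [show VectorCalculus.divergence (ψ z.1) z.2 = 0 from hdiv0 z hzK, mul_zero])]
  have e3 : ∫ z : ℝ × (EuclideanSpace ℝ (Fin 3)),
      (p z.1 z.2 - q z.1 z.2) * VectorCalculus.divergence (ψ z.1) z.2 =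
      ∫ z : ℝ × (EuclideanSpace ℝ (Fin 3)), (p z.1 z.2 * VectorCalculus.divergence (ψ z.1) z.2 -
        q z.1 z.2 * VectorCalculus.divergence (ψ z.1) z.2) := by
    refine integral_congr_ae (Eventually.of_forall fun z => ?_)
    ring
  show ∫ z : ℝ × (EuclideanSpace ℝ (Fin 3)),
      (p z.1 z.2 - q z.1 z.2) * VectorCalculus.divergence (ψ z.1) z.2 = 0
  rw [e3, integral_sub iP₁ iP₂]
  linarith


/-! ### `D` does not distinguish two pressures of one velocity -/

/-- **`D(Q(z,r); ·)` only sees the slices a.e.**: if `p`, `p'` are a.e.-strongly measurable on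
`Q(z,r)` and for a.e. `t ∈ (z.1 − r², z.1)` the slices `p(t,·)`, `p'(t,·)` agree a.e. on `B(z.2, r)`,
then `D(Q(z,r); p) = D(Q(z,r); p')` (Tonelli; the ball means agree slice by slice). [folklore] -/
theorem cknDOsc_congr_ae_slices {r : ℝ} {z : ℝ × EuclideanSpace ℝ (Fin 3)}
    {p p' : ℝ → EuclideanSpace ℝ (Fin 3) → ℝ}
    (hp : AEStronglyMeasurable (uncurry p) (volume.restrict (parabolicCylinder r z)))
    (hp' : AEStronglyMeasurable (uncurry p') (volume.restrict (parabolicCylinder r z)))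
    (h : ∀ᵐ t ∂(volume.restrict (Ioo (z.1 - r ^ 2) z.1)),
      ∀ᵐ x ∂(volume.restrict (ball z.2 r)), p t x = p' t x) :
    cknDOsc r z p = cknDOsc r z p' := by
  have hQ : parabolicCylinder r z = Ioo (z.1 - r ^ 2) z.1 ×ˢ ball z.2 r := rfl
  unfold cknDOsc
  congr 1
  rw [hQ] at hp hp' ⊢
  have hFm : ∀ {π : ℝ → EuclideanSpace ℝ (Fin 3) → ℝ},
      AEStronglyMeasurable (uncurry π) (volume.restrict (Ioo (z.1 - r ^ 2) z.1 ×ˢ ball z.2 r)) →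
      AEMeasurable (fun w : ℝ × EuclideanSpace ℝ (Fin 3) =>
        ‖π w.1 w.2 - ⨍ y in ball z.2 r, π w.1 y‖ₑ ^ (3 / 2 : ℝ))
        ((volume.restrict (Ioo (z.1 - r ^ 2) z.1)).prod (volume.restrict (ball z.2 r))) := by
    intro π hπ
    have h1 : AEStronglyMeasurable (fun w : ℝ × EuclideanSpace ℝ (Fin 3) => ⨍ y in ball z.2 r, π w.1 y)
        (volume.restrict (Ioo (z.1 - r ^ 2) z.1 ×ˢ ball z.2 r)) :=
      aestronglyMeasurable_setAverage_slice hπ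
    have h2 : AEStronglyMeasurable
        (fun w : ℝ × EuclideanSpace ℝ (Fin 3) => π w.1 w.2 - ⨍ y in ball z.2 r, π w.1 y)
        (volume.restrict (Ioo (z.1 - r ^ 2) z.1 ×ˢ ball z.2 r)) := hπ.sub h1
    rw [volume_restrict_prod_eq] at h2
    exact h2.aemeasurable.enorm.pow_const _
  rw [volume_restrict_prod_eq, lintegral_prod _ (hFm hp), lintegral_prod _ (hFm hp')]
  refine lintegral_congr_ae ?_
  filter_upwards [h] with t ht
  have havg : ⨍ y in ball z.2 r, p t y = ⨍ y in ball z.2 r, p' t y := average_congr ht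
  refine lintegral_congr_ae ?_
  filter_upwards [ht] with x hx
  rw [hx, havg]

/-- **The classical pressure and the suitable pressure of one velocity have the same `D` on every
backward ball.** Let `(v, p)` be a suitable weak solution on the slab `ℝ³ × ℝ₋` and `(v, q)` a
classical solution on `(−∞, 0)` with the same velocity. Then for `r > 0` and `z.1 ≤ 0`,
`D(Q(z,r); q) = D(Q(z,r); p)`: on the window `(z.1 − r² − 1, 0)` the two pressures differ by a
measurable function of time (`exists_gauge_of_distributional_of_classical`), which the mean-free
`D` does not see (`cknDOsc_sub_timeFun'`, `cknDOsc_congr_ae_slices`).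
[cite: AlbrittonBarker2019, §1 and §3 (the pressure is determined up to a function of time, invisible to D); RusinSverak2011, §2] -/
theorem cknDOsc_classical_eq {v : ℝ → EuclideanSpace ℝ (Fin 3) → EuclideanSpace ℝ (Fin 3)}
    {p q : ℝ → EuclideanSpace ℝ (Fin 3) → ℝ}
    (hsw : IsSuitableWeakSolutionOn
      (slab (EuclideanSpace ℝ (Fin 3)) (Iio 0) isOpen_Iio) 1 0 v p)
    (hcl : IsClassicalNSSolutionOn (Iio 0) 1 0 v q)
    {r : ℝ} (hr : 0 < r) {z : ℝ × EuclideanSpace ℝ (Fin 3)} (hz0 : z.1 ≤ 0) :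
    cknDOsc r z q = cknDOsc r z p := by
  -- the window `(z.1 - r² - 1, 0)` and the gauge
  set T₁ : ℝ := z.1 - r ^ 2 - 1 with hT₁
  have hIW : Ioo (z.1 - r ^ 2) z.1 ⊆ Ioo T₁ 0 := fun t ht =>
    ⟨by rw [hT₁]; linarith [ht.1], lt_of_lt_of_le ht.2 hz0⟩
  have hQsub : parabolicCylinder r z ⊆ Iio (0 : ℝ) ×ˢ (univ : Set (EuclideanSpace ℝ (Fin 3))) :=
    parabolicCylinder_subset_lowerHalf hz0 r
  have hle : slab (EuclideanSpace ℝ (Fin 3)) (Ioo T₁ 0) isOpen_Ioo ≤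
      slab (EuclideanSpace ℝ (Fin 3)) (Iio 0) isOpen_Iio := slab_mono fun t ht => ht.2
  have hD₁ : IsDistributionalNSSolutionOn
      (slab (EuclideanSpace ℝ (Fin 3)) (Ioo T₁ 0) isOpen_Ioo) 1 0 v p :=
    (hsw.of_le hle).distributional
  obtain ⟨c, hcm, hc⟩ :=
    exists_gauge_of_distributional_of_classical hD₁ isOpen_Iio (fun t ht => ht.2) hcl
  -- continuity of `q` on the slab
  have hqc : ContinuousOn (uncurry q) (Iio (0 : ℝ) ×ˢ (univ : Set (EuclideanSpace ℝ (Fin 3)))) :=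
    hcl.smooth_pressure.continuousOn
  -- `D(q) = D(q + c)`
  have hqli : ∀ t ∈ Ioo (z.1 - r ^ 2) z.1, LocallyIntegrable (q t) volume := by
    intro t ht
    have ht0 : t < 0 := lt_of_lt_of_le ht.2 hz0
    exact ((hcl.smooth_pressure.contDiff_slice ht0).continuous).locallyIntegrable
  have h1 : cknDOsc r z q = cknDOsc r z (fun t x => q t x + c t) := by
    have h := HardyAncientLimit.cknDOsc_sub_timeFun' hqli (fun t => -c t) hr
    have e : (fun t x => q t x - -c t) = fun t x => q t x + c t := by
      funext t x; ring
    rw [e] at h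
    exact h.symm
  rw [h1]
  -- `D(q + c) = D(p)` : the slices agree a.e.
  have hslab : ((slab (EuclideanSpace ℝ (Fin 3)) (Iio 0) isOpen_Iio :
      Opens (ℝ × EuclideanSpace ℝ (Fin 3))) : Set (ℝ × EuclideanSpace ℝ (Fin 3))) =
      Iio (0 : ℝ) ×ˢ (univ : Set (EuclideanSpace ℝ (Fin 3))) := coe_slab _ _
  have hpm : AEStronglyMeasurable (uncurry p) (volume.restrict (parabolicCylinder r z)) := by
    have h := hsw.distributional.2.2.1.aestronglyMeasurable
    rw [hslab] at h
    exact h.mono_measure (Measure.restrict_mono hQsub le_rfl)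
  have hqm : AEStronglyMeasurable (uncurry fun t x => q t x + c t)
      (volume.restrict (parabolicCylinder r z)) := by
    have h1 : AEStronglyMeasurable (uncurry q) (volume.restrict (parabolicCylinder r z)) :=
      (hqc.mono hQsub).aestronglyMeasurable (isOpen_parabolicCylinder r z).measurableSet
    have h2 : AEStronglyMeasurable (fun w : ℝ × EuclideanSpace ℝ (Fin 3) => c w.1)
        (volume.restrict (parabolicCylinder r z)) :=
      (hcm.comp measurable_fst).aestronglyMeasurable
    exact h1.add h2
  refine cknDOsc_congr_ae_slices hqm hpm ?_
  filter_upwards [ae_restrict_of_ae_restrict_of_subset hIW hc] with t ht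
  filter_upwards [ae_restrict_of_ae ht] with x hx
  show q t x + c t = p t x
  linarith

/-- **`𝐈` of the representative with the classical pressure equals `𝐈` of the given triple.**
If `u = v` a.e. on the slab, `(v, p)` is suitable on the slab and `(v, q)` is classical on
`(−∞, 0)`, then `𝐈(ℝ³ × ℝ₋; v, q, G) = 𝐈(ℝ³ × ℝ₋; u, p, G)`: ball by ball, `A` and `C` only see
the velocity a.e. (`cknAEss_congr_ae`, `cknC_congr_ae`), `D` does not distinguish the two pressures
(`cknDOsc_classical_eq`), and `E` is computed from the same `G`. [cite: AlbrittonBarker2019, §1] -/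
theorem typeIBound_classical_eq
    {u v : ℝ → EuclideanSpace ℝ (Fin 3) → EuclideanSpace ℝ (Fin 3)}
    {p q : ℝ → EuclideanSpace ℝ (Fin 3) → ℝ}
    {G : ℝ → EuclideanSpace ℝ (Fin 3) → EuclideanSpace ℝ (Fin 3) →L[ℝ] EuclideanSpace ℝ (Fin 3)}
    (hae : ∀ᵐ w ∂(volume.restrict (Iio (0 : ℝ) ×ˢ (univ : Set (EuclideanSpace ℝ (Fin 3))))),
      uncurry u w = uncurry v w)
    (hsw : IsSuitableWeakSolutionOn
      (slab (EuclideanSpace ℝ (Fin 3)) (Iio 0) isOpen_Iio) 1 0 v p)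
    (hcl : IsClassicalNSSolutionOn (Iio 0) 1 0 v q) :
    typeIBound (Iio (0 : ℝ) ×ˢ univ) v q G = typeIBound (Iio (0 : ℝ) ×ˢ univ) u p G := by
  unfold typeIBound
  refine iSup_congr fun r => iSup_congr fun hr => iSup_congr fun z => iSup_congr fun hz => ?_
  have hz0 : z.1 ≤ 0 := HardyAncientLimit.fst_nonpos_of_parabolicCylinder_subset hr hz
  have hQu : ∀ᵐ w ∂(volume.restrict (parabolicCylinder r z)), uncurry u w = uncurry v w :=
    ae_restrict_of_ae_restrict_of_subset hz hae
  unfold abScaledSum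
  rw [cknAEss_congr_ae hQu, cknC_congr_ae hQu, cknDOsc_classical_eq hsw hcl hr hz0]

end SmoothRepresentative

end Summit.NavierStokesRegularity.NavierStokesRegularity.Theorems

end
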